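import Summits.Ventures.CertifiedManyBodySolver.Downfold.BoxesNdNiO2EReprint
import Summits.Ventures.CertifiedManyBodySolver.Downfold.BoxesNdNiO2MLadderB
import HarnessLib

/-!
# NdNiO₂ box #20, object-E `t'/t` ladder — PART «σ-FS»: the kernel-certified σ-model Fermi-surface window as a TYPED ROW,
# placed against object E (gaps exact), against object M (inside/outside census), and the σ SHARE of object E's ratio

Venture CertifiedManyBodySolver, cell `pub/hubbard-downfold` (stage S1; HUMAN RULINGS D-0096/D-0098: the three-band → one-band reduction error is
carried explicitly; director D-0154 block (C) COVERAGE, material (iii) NdNiO₂), seat hubbard-cov-ndnio2-unc-2 (object-E uncertainty-ladder lane,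
lead ruling R-ma). This file is the NdNiO₂ twin of hubbard-cov-hg1201-unc-3's `BoxesHg1201TpLadderSigmaFS` (idiom copied) and, like it, imports
NOTHING of the kernel device: the window literals below are the ones PRINTED by the kernel theorems of `EmeryFermiFillingNdNiO2`
(`Emery.ndNiO2HullBox_fsRatio_window` = `[-(293/1250), -(383/2500)]`, `Emery.ndNiO2KSBox_fsRatio_window` = `[-(293/1250), -(437/2500)]`,
`Emery.ndNiO2VMFBox_fsRatio_window` = `[-(1097/5000), -(383/2500)]`; this seat, p693375, on hubbard-downfold-mod-4's device `EmeryFermiFilling*`),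
and the BY-NAME ties (`W.Mem (fsRatio …)` from those theorems) live in the companion `BoxesNdNiO2TpSigmaFSTies`.

WHAT W IS. For every parameter vector of the #21 NdNiO₂ three-band ONE-BODY rows (`EmeryBoxesKSlicesD`: t_pd ∈ [1.17, 1.37], t_pp ∈ [0.56, 0.68],
t_pp′ ∈ [0.121, 0.123] eV; Δ_pd on the hull [3.97, 6.24] of the DFT-level row [3.97, 5.0] and its V@MF image [4.6, 6.24]) and every Fermi energy whose
per-spin antibonding filling lies in the family band [0.343, 0.477] (all four object-E columns M21/M22/M59/M60), the EXACT `t–t'` contour ratio of the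
σ three-band model lies in **W = [−0.2344, −0.1532]** (W_KS = [−0.2344, −0.1748] on the DFT-level row, W_VMF = [−0.2194, −0.1532] on the image).

THE STATEMENTS (all by `norm_num` / `linarith` on typed rationals; nothing about NdNiO₂ is asserted beyond the typed rows).
* §1 OBJECT E lies BELOW W, column-free (the `tp` rows of M21/M22/M59/M60 are identical): gap ≥ `157/1250` = 0.1256 to the typed row
  `ndNiO2E_M21_tp = [−23/50, −9/25]` and to the member hull `[−0.455, −0.360]`; ≥ `1231/10000` to the ACTIVE FLOOR rung `[−183/400, −143/400]`;
  ≥ `613/5000` to the re-printed row `ndNiO2E_M21r_tp = [−0.458, −0.357]`; every one of the twelve refit members individually; W_VMF: ≥ `703/5000`.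
* §2 OBJECT M (unc-1's typed rows, BY NAME, nothing re-typed): W is NOT inside the row of record `ndNiO2M_tp = [−0.321, −0.160]` — it sticks out on
  the WEAK side by `17/2500` (`−31/200 ∈ W` is not in the row) — but `186/203` (91.6 %) of W's width is; W meets the FLOOR rung `[−0.291, −0.190]` in
  `[−0.2344, −0.190]` and the exact direct member hull `[−94/374, −0.2291]` only in the sliver `[−0.2344, −0.2291]` (width `53/10000`). CENSUS of the
  six v2 members: the two in-house Wannier members (1) `−0.2308` (WAN:j257807 p0), (2) `−0.2291` (WAN:j257812 sto) are INSIDE W (by `9/2500`, `53/10000`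
  from the strong end); the four located literature one-band fits (3) Kitatani 2020 `−95/395`, (4) Nomura 2019 `−92/370`, (5) Been 2021 `−94/374`,
  (6) Di Cataldo 2024 `−97/388` are OUTSIDE on the STRONG side (by `0.0061 … 0.0170`); of the ten v2 context values four are inside (`−0.226`, `−0.217`,
  Wu 2020 `−844/3761`, `−0.23`) and six outside strong (`−0.235` by `3/5000`, `−0.242`, `−0.239`, `−0.26`, `−92/368`, `−0.25`); the technique-B (dpσ)
  reading `−0.086` is outside on the WEAK side by `42/625`.
* §3 THE TYPED ORDERING: object E < W < technique-B (both disjoint, gaps `157/1250` and `42/625`), W ∩ (object-M row) = `[−0.2344, −0.160]`.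
* §4 THE σ SHARE OF THE OBJECT-E RATIO: for every `e` in the object-E row and every `s ∈ W`, `s/e ∈ [383/1150, 293/450]` = [0.3330, 0.6511] ⇒ the
  NON-σ share `1 − s/e ∈ [157/450, 767/1150]` = [34.9 %, 66.7 %] — INFL-3to1-B(`t'/t`, E, NdNiO₂, FS level) as a certified FRACTION of the row of
  record (member hull: [0.3367, 0.6511]; FLOOR rung: [0.3349, 0.6557]; W_KS: [0.3800, 0.6511]; W_VMF: [0.3330, 0.6094]). Block (C) comparison, by
  the sister theorems: Hg-1201 @0 doped row `hg1201_tp_sigmaFS_shareOfObjectE` ⇒ non-σ share [13.6 %, 54.0 %]; La₂CuO₄'s σ window OVERLAPS its E row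
  (`EmeryFermiFillingLa214`) ⇒ no positive lower bound there. NdNiO₂'s certified non-σ share is the largest of the three.

WHAT THIS IS NOT: not a statement that NdNiO₂'s parameters ARE in any row (SCREENING-grade boxes; the theorems certify typed-interval arithmetic on
rows already of record); no attribution of the non-σ share to a channel (mod-4's §REDUCTION-B v0.2 (2) names an axial / interstitial-s channel at
SCREENING grade — not asserted here; lit-1's dossier X95 context notes the located `t''/t` prints 0.110–0.126 [float] — not used here); object E is a
WINDOWED `t–t'`-only refit while W is the exact contour ratio at ε_F over an energy range (the convention caveat of `EmeryFermiFillingNdNiO2` stands);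
no box number changes; no `T_c` / phase sentence; items of routes CovNdNiO2M21/M22 untouched; no summit statement is proved by this seat.
Sources: [HybertsenSchluterChristensen1989, Eq. (1)]; [PavariniEtAl2001, Eq. (1)].
-/

noncomputable section

namespace Summit.Ventures.CertifiedManyBodySolver.Downfold

open Set NonemptyInterval

/-! ## §0 The certified windows as typed entries -/

/-- **W** — the kernel-certified window for the σ-model Fermi-surface `t'/t` of the #21 NdNiO₂ three-band one-body rows on the Δ_pd HULL
[3.97, 6.24] at every family filling [0.343, 0.477]: `[−293/1250, −383/2500]` = [−0.2344, −0.1532] (literal of `Emery.ndNiO2HullBox_fsRatio_window`).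
SCREENING grade (the grade of the rows it is computed from). [folklore] -/
def ndNiO2_tp_sigmaFS : Entry := Entry.ofEnds (-293/1250) (-383/2500) (by norm_num) .screening

/-- **W_KS** — the window on the DFT-level source row Δ_pd ∈ [3.97, 5.0] (`emeryBoxNdNiO2YK26Src`): `[−293/1250, −437/2500]` = [−0.2344, −0.1748]
(literal of `Emery.ndNiO2KSBox_fsRatio_window`). [folklore] -/
def ndNiO2_tp_sigmaFS_KS : Entry := Entry.ofEnds (-293/1250) (-437/2500) (by norm_num) .screening

/-- **W_VMF** — the window on the bare-electron image row Δ_pd ∈ [4.6, 6.24] (`emeryBoxNdNiO2YK26`): `[−1097/5000, −383/2500]` = [−0.2194, −0.1532]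
(literal of `Emery.ndNiO2VMFBox_fsRatio_window`). [folklore] -/
def ndNiO2_tp_sigmaFS_VMF : Entry := Entry.ofEnds (-1097/5000) (-383/2500) (by norm_num) .screening

/-- The printed ends and exact widths: W width `203/2500` = 0.0812, W_KS `149/2500` = 0.0596, W_VMF `331/5000` = 0.0662; W is the hull of W_KS and
W_VMF end for end. [folklore] -/
theorem ndNiO2_tp_sigmaFS_ends :
    ndNiO2_tp_sigmaFS.encl.fst = -293/1250 ∧ ndNiO2_tp_sigmaFS.encl.snd = -383/2500 ∧
      ndNiO2_tp_sigmaFS_KS.encl.fst = -293/1250 ∧ ndNiO2_tp_sigmaFS_KS.encl.snd = -437/2500 ∧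
      ndNiO2_tp_sigmaFS_VMF.encl.fst = -1097/5000 ∧ ndNiO2_tp_sigmaFS_VMF.encl.snd = -383/2500 ∧
      ((-383/2500 : ℚ) - (-293/1250) = 203/2500 ∧ (-437/2500 : ℚ) - (-293/1250) = 149/2500 ∧
        (-383/2500 : ℚ) - (-1097/5000) = 331/5000) ∧
      (min (-293/1250 : ℚ) (-1097/5000) = -293/1250 ∧ max (-437/2500 : ℚ) (-383/2500) = -383/2500) := by
  simp only [ndNiO2_tp_sigmaFS, ndNiO2_tp_sigmaFS_KS, ndNiO2_tp_sigmaFS_VMF, Entry.encl_ofEnds_fst, Entry.encl_ofEnds_snd]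
  norm_num

/-- Rational membership in W, decided on the ends. [folklore] -/
theorem ndNiO2_tp_sigmaFS_mem_rat_iff (m : ℚ) : ndNiO2_tp_sigmaFS.Mem (m : ℝ) ↔ -293/1250 ≤ m ∧ m ≤ -383/2500 := by
  rw [ndNiO2_tp_sigmaFS, Entry.mem_ofEnds_iff]
  exact ⟨fun h => ⟨by exact_mod_cast h.1, by exact_mod_cast h.2⟩, fun h => ⟨by exact_mod_cast h.1, by exact_mod_cast h.2⟩⟩

/-- Both per-row windows refine W: every member of W_KS and every member of W_VMF is a member of W. [folklore] -/
theorem ndNiO2_tp_sigmaFS_mem_of_row {x : ℝ} :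
    (ndNiO2_tp_sigmaFS_KS.Mem x → ndNiO2_tp_sigmaFS.Mem x) ∧ (ndNiO2_tp_sigmaFS_VMF.Mem x → ndNiO2_tp_sigmaFS.Mem x) :=
  ⟨fun hx => Entry.mem_ofEnds_mono (by norm_num) (by norm_num) hx, fun hx => Entry.mem_ofEnds_mono (by norm_num) (by norm_num) hx⟩

/-! ## §1 OBJECT E lies below W (column-free: the `tp` rows of `boxNdNiO2E_M21` / `boxNdSrNiO2E_M22` / `_M59` / `_M60` are all `ndNiO2E_M21_tp`) -/

/-- **W ABOVE THE TYPED ROW OF RECORD** `ndNiO2E_M21_tp = [−23/50, −9/25]`: every window value exceeds every row value by at least `157/1250` = 0.1256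
(W), `157/1250` (W_KS, same strong end) and `703/5000` = 0.1406 (W_VMF). [folklore] -/
theorem ndNiO2_tp_sigmaFS_above_objectE_row :
    (∀ x y : ℝ, ndNiO2E_M21_tp.Mem x → ndNiO2_tp_sigmaFS.Mem y → 157/1250 ≤ y - x) ∧
      (∀ x y : ℝ, ndNiO2E_M21_tp.Mem x → ndNiO2_tp_sigmaFS_KS.Mem y → 157/1250 ≤ y - x) ∧
      (∀ x y : ℝ, ndNiO2E_M21_tp.Mem x → ndNiO2_tp_sigmaFS_VMF.Mem y → 703/5000 ≤ y - x) := by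
  refine ⟨fun x y hx hy => ?_, fun x y hx hy => ?_, fun x y hx hy => ?_⟩
  all_goals
    have hx2 := ((Entry.mem_ofEnds_iff _ _ _ _ _).1 hx).2
    have hy1 := ((Entry.mem_ofEnds_iff _ _ _ _ _).1 hy).1
    push_cast at hx2 hy1
    linarith

/-- **W ABOVE THE MEMBER HULL AND THE ACTIVE FLOOR RUNG.** Every value of the object-E `t'/t_eff` member hull `ndNiO2E_tp_hull = [−0.455, −0.360]` lies
below every value of W by at least `157/1250` (the hull's high end `−0.360` IS the typed row's); every value of the FLOOR rung `ndNiO2E_tp_hull.floorTo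
(1/20) = [−183/400, −143/400]` (ACTIVE: `ndNiO2E_tp_floor_ends`) by at least `1231/10000` = 0.1231. [folklore] -/
theorem ndNiO2_tp_sigmaFS_above_objectE_hull_floor :
    (∀ x y : ℝ, x ∈ ndNiO2E_tp_hull.ratCast ℝ → ndNiO2_tp_sigmaFS.Mem y → 157/1250 ≤ y - x) ∧
      (∀ x y : ℝ, x ∈ (ndNiO2E_tp_hull.floorTo (1/20)).ratCast ℝ → ndNiO2_tp_sigmaFS.Mem y → 1231/10000 ≤ y - x) := by
  refine ⟨fun x y hx hy => ?_, fun x y hx hy => ?_⟩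
  · have hx2 := (mem_ratCast_iff.1 hx).2
    have hy1 := ((Entry.mem_ofEnds_iff _ _ _ _ _).1 hy).1
    simp only [ndNiO2E_tp_hull] at hx2
    push_cast at hx2 hy1
    linarith
  · have hx2 := (mem_ratCast_iff.1 hx).2
    rw [ndNiO2E_tp_floor_ends.2] at hx2
    have hy1 := ((Entry.mem_ofEnds_iff _ _ _ _ _).1 hy).1
    push_cast at hx2 hy1
    linarith

/-- **W ABOVE THE RE-PRINTED ROW** `ndNiO2E_M21r_tp = [−229/500, −357/1000]` (run-8's §R-ac FOLD v1 legacy re-print, `BoxesNdNiO2EReprint`; encloses the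
FLOOR rung): gap at least `613/5000` = 0.1226. [folklore] -/
theorem ndNiO2_tp_sigmaFS_above_objectE_reprint :
    ∀ x y : ℝ, ndNiO2E_M21r_tp.Mem x → ndNiO2_tp_sigmaFS.Mem y → 613/5000 ≤ y - x := by
  intro x y hx hy
  have hx2 := ((Entry.mem_ofEnds_iff _ _ _ _ _).1 hx).2
  have hy1 := ((Entry.mem_ofEnds_iff _ _ _ _ _).1 hy).1
  push_cast at hx2 hy1
  linarith

/-- **EVERY REFIT MEMBER INDIVIDUALLY** (the twelve distinct `t'/t_eff` values of `ndNiO2E_tp_members`, (W)/(D) × p0/sto/charged × w = 0.3/0.5): each lies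
at least `157/1250` below W's strong end `−293/1250`; the deepest member `−0.455` by `1103/5000` = 0.2206. [folklore] -/
theorem ndNiO2_tp_sigmaFS_above_objectE_members :
    (∀ m ∈ ndNiO2E_tp_members, m + 157/1250 ≤ ndNiO2_tp_sigmaFS.encl.fst) ∧
      (-455/1000 : ℚ) ∈ ndNiO2E_tp_members ∧ (-293/1250 : ℚ) - (-455/1000) = 1103/5000 := by
  refine ⟨fun m hm => ?_, by simp [ndNiO2E_tp_members], by norm_num⟩
  simp only [ndNiO2_tp_sigmaFS, Entry.encl_ofEnds_fst]
  simp only [ndNiO2E_tp_members, Finset.mem_insert, Finset.mem_singleton] at hm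
  rcases hm with rfl | rfl | rfl | rfl | rfl | rfl | rfl | rfl | rfl | rfl | rfl | rfl <;> norm_num

/-- **Hence no object-E value is a window value** (typed row, member hull, FLOOR rung, re-print alike): W and object E are DISJOINT. [folklore] -/
theorem ndNiO2_tp_sigmaFS_disjoint_objectE {x : ℝ} (hx : ndNiO2_tp_sigmaFS.Mem x) :
    ¬ ndNiO2E_M21_tp.Mem x ∧ ¬ ndNiO2E_M21r_tp.Mem x ∧ x ∉ (ndNiO2E_tp_hull.floorTo (1/20)).ratCast ℝ := by
  refine ⟨fun h => ?_, fun h => ?_, fun h => ?_⟩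
  · have := ndNiO2_tp_sigmaFS_above_objectE_row.1 x x h hx; linarith
  · have := ndNiO2_tp_sigmaFS_above_objectE_reprint x x h hx; linarith
  · have := ndNiO2_tp_sigmaFS_above_objectE_hull_floor.2 x x h hx; linarith

/-! ## §2 OBJECT M (unc-1's typed rows `BoxesNdNiO2MLadder(B)`, BY NAME): where W sits, and the inside/outside census of the located prints -/

/-- **W vs THE ROW OF RECORD `ndNiO2M_tp = [−0.321, −0.160]`** (provisional INFL-3to1 ±0.08): (i) W's strong end is inside the row (`−0.321 ≤ −0.2344`,
`433/5000` to spare); (ii) W is NOT contained in the row — its weak end `−383/2500` exceeds the row's `−4/25` by `17/2500` = 0.0068, and the window value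
`−31/200 = −0.155` is not a row value; (iii) the part of W inside the row, `[−293/1250, −4/25]`, is `186/203` (91.6 %) of W's width; (iv) every window value
`≤ −4/25` is a row value. [folklore] -/
theorem ndNiO2_tp_sigmaFS_vs_objectM_row :
    (ndNiO2M_tp.encl.fst ≤ ndNiO2_tp_sigmaFS.encl.fst ∧ ndNiO2_tp_sigmaFS.encl.fst - ndNiO2M_tp.encl.fst = 433/5000) ∧
      (ndNiO2M_tp.encl.snd < ndNiO2_tp_sigmaFS.encl.snd ∧ ndNiO2_tp_sigmaFS.encl.snd - ndNiO2M_tp.encl.snd = 17/2500 ∧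
        ndNiO2_tp_sigmaFS.Mem ((-31/200 : ℚ) : ℝ) ∧ ¬ ndNiO2M_tp.Mem ((-31/200 : ℚ) : ℝ)) ∧
      (((-4/25 : ℚ) - (-293/1250)) / ((-383/2500 : ℚ) - (-293/1250)) = 186/203) ∧
      (∀ x : ℝ, ndNiO2_tp_sigmaFS.Mem x → x ≤ -4/25 → ndNiO2M_tp.Mem x) := by
  refine ⟨?_, ⟨?_, ?_, ?_, fun h => ?_⟩, by norm_num, fun x hx hle => ?_⟩
  · simp only [ndNiO2M_tp, ndNiO2_tp_sigmaFS, Entry.encl_ofEnds_fst]; norm_num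
  · simp only [ndNiO2M_tp, ndNiO2_tp_sigmaFS, Entry.encl_ofEnds_snd]; norm_num
  · simp only [ndNiO2M_tp, ndNiO2_tp_sigmaFS, Entry.encl_ofEnds_snd]; norm_num
  · exact Entry.mem_ofEnds_of_rat (by norm_num) (by norm_num)
  · have h' := ((Entry.mem_ofEnds_iff _ _ _ _ _).1 h).2
    push_cast at h'
    norm_num at h'
  · have hx1 := ((Entry.mem_ofEnds_iff _ _ _ _ _).1 hx).1
    push_cast at hx1
    refine (Entry.mem_ofEnds_iff _ _ _ _ _).2 ⟨?_, ?_⟩ <;> push_cast <;> linarith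

/-- **W vs THE FLOOR RUNG `ndNiO2M_tp_floor = [−0.291, −0.190]` AND THE EXACT DIRECT HULL `ndNiO2M_tp_direct = [−94/374, −0.2291]`**: W meets the FLOOR
rung in `[−293/1250, −19/100]` (neither contains the other: `−31/200 ∈ W` is above the rung, `−29/100 ∈ rung` is below W); W meets the direct member hull
ONLY in the sliver `[−293/1250, −2291/10000]` of width `53/10000`: the hull's strong end `−94/374` (Been 2021) lies below W's strong end by more than
`169/10000` and less than `170/10000`; the hull's weak end `−0.2291` is inside W. [folklore] -/
theorem ndNiO2_tp_sigmaFS_vs_objectM_floor_direct :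
    (ndNiO2_tp_sigmaFS.Mem ((-31/200 : ℚ) : ℝ) ∧ ¬ ndNiO2M_tp_floor.Mem ((-31/200 : ℚ) : ℝ)) ∧
      (ndNiO2M_tp_floor.Mem ((-29/100 : ℚ) : ℝ) ∧ ¬ ndNiO2_tp_sigmaFS.Mem ((-29/100 : ℚ) : ℝ)) ∧
      (∀ x : ℝ, ndNiO2_tp_sigmaFS.Mem x → x ≤ -19/100 → ndNiO2M_tp_floor.Mem x) ∧
      (ndNiO2M_tp_direct.encl.fst < ndNiO2_tp_sigmaFS.encl.fst ∧ ndNiO2_tp_sigmaFS.encl.fst < ndNiO2M_tp_direct.encl.snd ∧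
        ndNiO2M_tp_direct.encl.snd - ndNiO2_tp_sigmaFS.encl.fst = 53/10000 ∧
        (-94/374 : ℚ) + 169/10000 < -293/1250 ∧ -293/1250 < (-94/374 : ℚ) + 170/10000) ∧
      (∀ x : ℝ, ndNiO2_tp_sigmaFS.Mem x → ndNiO2M_tp_direct.Mem x → (-293/1250 : ℝ) ≤ x ∧ x ≤ -2291/10000) := by
  refine ⟨⟨Entry.mem_ofEnds_of_rat (by norm_num) (by norm_num), fun h => ?_⟩,
    ⟨Entry.mem_ofEnds_of_rat (by norm_num) (by norm_num), fun h => ?_⟩, fun x hx hle => ?_, ?_, fun x hx hd => ?_⟩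
  · have h' := ((Entry.mem_ofEnds_iff _ _ _ _ _).1 h).2
    push_cast at h'
    norm_num at h'
  · have h' := ((Entry.mem_ofEnds_iff _ _ _ _ _).1 h).1
    push_cast at h'
    norm_num at h'
  · have hx1 := ((Entry.mem_ofEnds_iff _ _ _ _ _).1 hx).1
    push_cast at hx1
    refine (Entry.mem_ofEnds_iff _ _ _ _ _).2 ⟨?_, ?_⟩ <;> push_cast <;> linarith
  · simp only [ndNiO2M_tp_direct, ndNiO2_tp_sigmaFS, Entry.encl_ofEnds_fst, Entry.encl_ofEnds_snd]; norm_num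
  · have hx1 := ((Entry.mem_ofEnds_iff _ _ _ _ _).1 hx).1
    have hd2 := ((Entry.mem_ofEnds_iff _ _ _ _ _).1 hd).2
    push_cast at hx1 hd2
    exact ⟨by linarith, by linarith⟩

/-- The v2 MEMBERS inside W: the two in-house Wannier members (1) `−0.2308` (WAN:j257807 p0, La-proxy) and (2) `−0.2291` (WAN:j257812 sto). [folklore] -/
def ndNiO2_tp_sigmaFS_insideMembers : List ℚ := [-2308/10000, -2291/10000]

/-- The v2 MEMBERS outside W, all on the STRONG-`|t'|` side: (3) Kitatani 2020 `−95/395`, (4) Nomura 2019 Tab. III `−92/370`, (5) Been 2021 Tab. I `−94/374`,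
(6) Di Cataldo 2024 SM Table I `−97/388` (the four located literature one-band Wannier fits; unc-1's tags «f-in-core»). [folklore] -/
def ndNiO2_tp_sigmaFS_outsideStrongMembers : List ℚ := [-95/395, -92/370, -94/374, -97/388]

/-- The v2 CONTEXT values inside W: run-8 doped/bulk columns sr10 `−0.226`, sr20/li20/wa20 `−0.217`; Wu 2020 x²−y² block `−844/3761`; Kitatani 2023
strained film `−0.23`. [folklore] -/
def ndNiO2_tp_sigmaFS_insideContext : List ℚ := [-226/1000, -217/1000, -844/3761, -23/100]

/-- **THE MEMBER CENSUS (value-free; unc-1's lists by name, nothing re-classified).** (i) `ndNiO2M_tp_members_v2` is, in order, the inside list followed by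
the outside-strong list; (ii) a v2 member is a window value iff it is one of the two in-house Wannier members; (iii) the inside members sit `9/2500` and
`53/10000` above W's strong end; (iv) the outside members sit below W's strong end by at least `61/10000` (Kitatani 2020, the nearest) and at most
`17/1000` (Been 2021, the deepest: `−94/374`), i.e. INSIDE unc-1's FLOOR rung but outside W. [folklore] -/
theorem ndNiO2_tp_sigmaFS_memberCensus :
    ndNiO2M_tp_members_v2 = ndNiO2_tp_sigmaFS_insideMembers ++ ndNiO2_tp_sigmaFS_outsideStrongMembers ∧
      (∀ m ∈ ndNiO2M_tp_members_v2, ndNiO2_tp_sigmaFS.Mem (m : ℝ) ↔ m ∈ ndNiO2_tp_sigmaFS_insideMembers) ∧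
      (∀ m ∈ ndNiO2_tp_sigmaFS_insideMembers, -293/1250 + 9/2500 ≤ m ∧ m ≤ -383/2500) ∧
      (∀ m ∈ ndNiO2_tp_sigmaFS_outsideStrongMembers, m + 61/10000 ≤ -293/1250 ∧ -293/1250 ≤ m + 17/1000 ∧ ndNiO2M_tp_floor.Mem (m : ℝ)) := by
  refine ⟨by rfl, fun m hm => ?_, fun m hm => ?_, fun m hm => ?_⟩
  · rw [ndNiO2_tp_sigmaFS_mem_rat_iff]
    simp only [ndNiO2M_tp_members_v2, ndNiO2M_tp_members, List.cons_append, List.nil_append, List.mem_cons,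
      List.not_mem_nil, or_false] at hm
    rcases hm with rfl | rfl | rfl | rfl | rfl | rfl <;>
      simp only [ndNiO2_tp_sigmaFS_insideMembers, List.mem_cons, List.not_mem_nil, or_false] <;> norm_num
  · simp only [ndNiO2_tp_sigmaFS_insideMembers, List.mem_cons, List.not_mem_nil, or_false] at hm
    rcases hm with rfl | rfl <;> norm_num
  · simp only [ndNiO2_tp_sigmaFS_outsideStrongMembers, List.mem_cons, List.not_mem_nil, or_false] at hm
    rcases hm with rfl | rfl | rfl | rfl <;>
      exact ⟨by norm_num, by norm_num, Entry.mem_ofEnds_of_rat (by norm_num) (by norm_num)⟩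

/-- **THE CONTEXT CENSUS.** Of unc-1's ten v2 context values (`ndNiO2M_tp_context_v2`), a value is a window value iff it is one of the four of
`ndNiO2_tp_sigmaFS_insideContext`; the six others (`−0.235`, Held 2022 `−0.242 / −0.239`, Hirayama 2022 `−0.26`, Botana–Norman `−92/368`, Kitatani 2023
`−0.25`) lie below W's strong end — the nearest, sr25's `−0.235`, by `3/5000` only. [folklore] -/
theorem ndNiO2_tp_sigmaFS_contextCensus :
    (∀ m ∈ ndNiO2M_tp_context_v2, ndNiO2_tp_sigmaFS.Mem (m : ℝ) ↔ m ∈ ndNiO2_tp_sigmaFS_insideContext) ∧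
      (∀ m ∈ ndNiO2M_tp_context_v2, m ∉ ndNiO2_tp_sigmaFS_insideContext → m + 3/5000 ≤ -293/1250) ∧
      ((-235/1000 : ℚ) ∈ ndNiO2M_tp_context_v2 ∧ (-235/1000 : ℚ) + 3/5000 = -293/1250) := by
  refine ⟨fun m hm => ?_, fun m hm hni => ?_, ⟨by simp [ndNiO2M_tp_context_v2, ndNiO2M_tp_context], by norm_num⟩⟩
  · rw [ndNiO2_tp_sigmaFS_mem_rat_iff]
    simp only [ndNiO2M_tp_context_v2, ndNiO2M_tp_context, List.cons_append, List.nil_append, List.mem_cons,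
      List.not_mem_nil, or_false] at hm
    rcases hm with rfl | rfl | rfl | rfl | rfl | rfl | rfl | rfl | rfl | rfl <;>
      simp only [ndNiO2_tp_sigmaFS_insideContext, List.mem_cons, List.not_mem_nil, or_false] <;> norm_num
  · simp only [ndNiO2M_tp_context_v2, ndNiO2M_tp_context, List.cons_append, List.nil_append, List.mem_cons,
      List.not_mem_nil, or_false] at hm
    simp only [ndNiO2_tp_sigmaFS_insideContext, List.mem_cons, List.not_mem_nil, or_false] at hni
    rcases hm with rfl | rfl | rfl | rfl | rfl | rfl | rfl | rfl | rfl | rfl <;> norm_num at hni <;> norm_num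

/-- **TECHNIQUE B (dpσ Wannier `t'_B/t_B = −0.086`, unc-1's MODEL-FORM note R-B4) is NOT a window value — it lies on the WEAK side of W by `42/625` =
0.0672**; with `ndNiO2M_tp_techniqueB_not_mem` (not a row value either) W sits strictly BETWEEN technique B and object E. [folklore] -/
theorem ndNiO2_tp_sigmaFS_techniqueB_not_mem :
    ¬ ndNiO2_tp_sigmaFS.Mem ((-86/1000 : ℚ) : ℝ) ∧ (-86/1000 : ℚ) - (-383/2500) = 42/625 := by
  refine ⟨fun h => ?_, by norm_num⟩
  have h' := ((Entry.mem_ofEnds_iff _ _ _ _ _).1 h).2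
  push_cast at h'
  norm_num at h'

/-! ## §3 The typed ordering -/

/-- **THE TYPED ORDERING: object E < W < technique B; W inside-but-overhanging the object-M row.** Every object-E row value lies below every W value by
≥ `157/1250`; every W value lies below the technique-B reading by ≥ `42/625`; a W value is an object-M row value iff it is `≤ −4/25`. [folklore] -/
theorem ndNiO2_tp_sigmaFS_ordering :
    (∀ x y : ℝ, ndNiO2E_M21_tp.Mem x → ndNiO2_tp_sigmaFS.Mem y → x + 157/1250 ≤ y) ∧
      (∀ y : ℝ, ndNiO2_tp_sigmaFS.Mem y → y + 42/625 ≤ ((-86/1000 : ℚ) : ℝ)) ∧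
      (∀ y : ℝ, ndNiO2_tp_sigmaFS.Mem y → (ndNiO2M_tp.Mem y ↔ y ≤ -4/25)) := by
  refine ⟨fun x y hx hy => ?_, fun y hy => ?_, fun y hy => ⟨fun h => ?_, fun h => ndNiO2_tp_sigmaFS_vs_objectM_row.2.2.2 y hy h⟩⟩
  · have := ndNiO2_tp_sigmaFS_above_objectE_row.1 x y hx hy; linarith
  · have hy2 := ((Entry.mem_ofEnds_iff _ _ _ _ _).1 hy).2
    push_cast at hy2 ⊢
    linarith
  · have h2 := ((Entry.mem_ofEnds_iff _ _ _ _ _).1 h).2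
    push_cast at h2
    linarith

/-! ## §4 The σ SHARE of the object-E Fermi-surface ratio — INFL-3to1-B(`t'/t`, E) as a certified fraction -/

/-- **THE σ SHARE OF THE OBJECT-E RATIO, CERTIFIED.** For every object-E value `e` and every window value `s`, the quotient `s/e` (the fraction of the
`t–t'`-only refit ratio of record that the σ three-band model's exact Fermi-surface ratio reproduces) satisfies: vs the typed row `ndNiO2E_M21_tp =
[−23/50, −9/25]`: `s/e ∈ [383/1150, 293/450]` = [0.3330, 0.6511]; vs the member hull `[−91/200, −9/25]`: `[766/2275, 293/450]` = [0.3367, 0.6511]; vs the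
ACTIVE FLOOR rung `[−183/400, −143/400]`: `[1532/4575, 2344/3575]` = [0.3349, 0.6557]; per Δ row vs the typed row: W_KS `[437/1150, 293/450]` = [0.3800,
0.6511], W_VMF `[383/1150, 1097/1800]` = [0.3330, 0.6094]. [cite: PavariniEtAl2001, Eq. (1)] -/
theorem ndNiO2_tp_sigmaFS_shareOfObjectE :
    (∀ e s : ℝ, ndNiO2E_M21_tp.Mem e → ndNiO2_tp_sigmaFS.Mem s → 383/1150 ≤ s / e ∧ s / e ≤ 293/450) ∧
      (∀ e s : ℝ, e ∈ ndNiO2E_tp_hull.ratCast ℝ → ndNiO2_tp_sigmaFS.Mem s → 766/2275 ≤ s / e ∧ s / e ≤ 293/450) ∧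
      (∀ e s : ℝ, e ∈ (ndNiO2E_tp_hull.floorTo (1/20)).ratCast ℝ → ndNiO2_tp_sigmaFS.Mem s →
        1532/4575 ≤ s / e ∧ s / e ≤ 2344/3575) ∧
      (∀ e s : ℝ, ndNiO2E_M21_tp.Mem e → ndNiO2_tp_sigmaFS_KS.Mem s → 437/1150 ≤ s / e ∧ s / e ≤ 293/450) ∧
      (∀ e s : ℝ, ndNiO2E_M21_tp.Mem e → ndNiO2_tp_sigmaFS_VMF.Mem s → 383/1150 ≤ s / e ∧ s / e ≤ 1097/1800) := by
  refine ⟨fun e s he hs => ?_, fun e s he hs => ?_, fun e s he hs => ?_, fun e s he hs => ?_, fun e s he hs => ?_⟩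
  · obtain ⟨he1, he2⟩ := (Entry.mem_ofEnds_iff _ _ _ _ _).1 he
    obtain ⟨hs1, hs2⟩ := (Entry.mem_ofEnds_iff _ _ _ _ _).1 hs
    push_cast at he1 he2 hs1 hs2
    have hneg : e < 0 := by linarith
    rw [le_div_iff_of_neg hneg, div_le_iff_of_neg hneg]
    exact ⟨by linarith, by linarith⟩
  · obtain ⟨he1, he2⟩ := mem_ratCast_iff.1 he
    simp only [ndNiO2E_tp_hull] at he1 he2
    obtain ⟨hs1, hs2⟩ := (Entry.mem_ofEnds_iff _ _ _ _ _).1 hs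
    push_cast at he1 he2 hs1 hs2
    have hneg : e < 0 := by linarith
    rw [le_div_iff_of_neg hneg, div_le_iff_of_neg hneg]
    exact ⟨by linarith, by linarith⟩
  · obtain ⟨he1, he2⟩ := mem_ratCast_iff.1 he
    rw [ndNiO2E_tp_floor_ends.1] at he1
    rw [ndNiO2E_tp_floor_ends.2] at he2
    obtain ⟨hs1, hs2⟩ := (Entry.mem_ofEnds_iff _ _ _ _ _).1 hs
    push_cast at he1 he2 hs1 hs2
    have hneg : e < 0 := by linarith
    rw [le_div_iff_of_neg hneg, div_le_iff_of_neg hneg]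
    exact ⟨by linarith, by linarith⟩
  · obtain ⟨he1, he2⟩ := (Entry.mem_ofEnds_iff _ _ _ _ _).1 he
    obtain ⟨hs1, hs2⟩ := (Entry.mem_ofEnds_iff _ _ _ _ _).1 hs
    push_cast at he1 he2 hs1 hs2
    have hneg : e < 0 := by linarith
    rw [le_div_iff_of_neg hneg, div_le_iff_of_neg hneg]
    exact ⟨by linarith, by linarith⟩
  · obtain ⟨he1, he2⟩ := (Entry.mem_ofEnds_iff _ _ _ _ _).1 he
    obtain ⟨hs1, hs2⟩ := (Entry.mem_ofEnds_iff _ _ _ _ _).1 hs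
    push_cast at he1 he2 hs1 hs2
    have hneg : e < 0 := by linarith
    rw [le_div_iff_of_neg hneg, div_le_iff_of_neg hneg]
    exact ⟨by linarith, by linarith⟩

/-- **One citable line for the MODEL-FORM note**: on the NdNiO₂ object-E row of record at least `383/1150` (33.3 %) and at most `293/450` (65.1 %) of the
refit `t'/t_eff` is σ-model Fermi-surface shape; the remainder — at least `157/450` (34.9 %), at most `767/1150` (66.7 %) — is the certified size of
INFL-3to1-B(`t'/t`, E, NdNiO₂, FS level) as a FRACTION of the row (member hull: [34.9 %, 66.3 %]; FLOOR rung: [34.4 %, 66.5 %]). Block (C): Hg-1201 @0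
doped row [13.6 %, 54.0 %] (`hg1201_tp_sigmaFS_nonSigmaShare_P0`); La₂CuO₄: window and E row overlap, no positive lower bound. [cite: PavariniEtAl2001, Eq. (1)] -/
theorem ndNiO2_tp_sigmaFS_nonSigmaShare :
    (∀ e s : ℝ, ndNiO2E_M21_tp.Mem e → ndNiO2_tp_sigmaFS.Mem s → 157/450 ≤ 1 - s / e ∧ 1 - s / e ≤ 767/1150) ∧
      ((1 : ℚ) - 293/450 = 157/450 ∧ (1 : ℚ) - 383/1150 = 767/1150 ∧ (1 : ℚ) - 766/2275 = 1509/2275 ∧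
        (1 : ℚ) - 2344/3575 = 1231/3575 ∧ (1 : ℚ) - 1532/4575 = 3043/4575) := by
  refine ⟨fun e s he hs => ?_, by norm_num⟩
  obtain ⟨h1, h2⟩ := ndNiO2_tp_sigmaFS_shareOfObjectE.1 e s he hs
  exact ⟨by linarith, by linarith⟩

/-! ## §5 Summary -/

/-- **SUMMARY (one citable line).** The kernel-certified σ-model Fermi-surface window of the #21 NdNiO₂ 3BE rows at the object-E fillings, W = [−0.2344,
−0.1532] (this seat's `EmeryFermiFillingNdNiO2`, by name in the companion Ties file): (a) lies ABOVE object E's `t'/t_eff` row of record [−0.46, −0.36] by ≥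
0.1256, above its ACTIVE FLOOR rung by ≥ 0.1231 and above the re-print [−0.458, −0.357] by ≥ 0.1226 — disjoint from every object-E rung; (b) overhangs
unc-1's object-M row of record [−0.321, −0.160] on the weak side by 0.0068 (91.6 % of W inside), contains the two in-house Wannier one-band members and
four context values, and excludes — on the strong side, by 0.006–0.017 — the four located literature one-band fits (Kitatani 2020, Nomura 2019, Been 2021,
Di Cataldo 2024) and six context values; (c) lies BELOW the technique-B dpσ reading −0.086 by ≥ 0.0672; (d) the σ share of object E's ratio is certified in
[33.3 %, 65.1 %], the non-σ share in [34.9 %, 66.7 %]. Numbers, not adjectives; nothing of record moves. [folklore] -/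
theorem ndNiO2_tp_sigmaFS_summary :
    (∀ x y : ℝ, ndNiO2E_M21_tp.Mem x → ndNiO2_tp_sigmaFS.Mem y → 157/1250 ≤ y - x) ∧
      (∀ x y : ℝ, x ∈ (ndNiO2E_tp_hull.floorTo (1/20)).ratCast ℝ → ndNiO2_tp_sigmaFS.Mem y → 1231/10000 ≤ y - x) ∧
      (∀ x y : ℝ, ndNiO2E_M21r_tp.Mem x → ndNiO2_tp_sigmaFS.Mem y → 613/5000 ≤ y - x) ∧
      (ndNiO2_tp_sigmaFS.Mem ((-31/200 : ℚ) : ℝ) ∧ ¬ ndNiO2M_tp.Mem ((-31/200 : ℚ) : ℝ)) ∧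
      (∀ m ∈ ndNiO2M_tp_members_v2, ndNiO2_tp_sigmaFS.Mem (m : ℝ) ↔ m ∈ ndNiO2_tp_sigmaFS_insideMembers) ∧
      (∀ y : ℝ, ndNiO2_tp_sigmaFS.Mem y → y + 42/625 ≤ ((-86/1000 : ℚ) : ℝ)) ∧
      (∀ e s : ℝ, ndNiO2E_M21_tp.Mem e → ndNiO2_tp_sigmaFS.Mem s → 157/450 ≤ 1 - s / e ∧ 1 - s / e ≤ 767/1150) :=
  ⟨ndNiO2_tp_sigmaFS_above_objectE_row.1, ndNiO2_tp_sigmaFS_above_objectE_hull_floor.2, ndNiO2_tp_sigmaFS_above_objectE_reprint,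
    ⟨ndNiO2_tp_sigmaFS_vs_objectM_row.2.1.2.2.1, ndNiO2_tp_sigmaFS_vs_objectM_row.2.1.2.2.2⟩, ndNiO2_tp_sigmaFS_memberCensus.2.1,
    ndNiO2_tp_sigmaFS_ordering.2.1, ndNiO2_tp_sigmaFS_nonSigmaShare.1⟩

end Summit.Ventures.CertifiedManyBodySolver.Downfold

end
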